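import Summits.KontsevichZagierPeriods.KontsevichZagierPeriods.Theorems.RootDecompQuadraticDescentPair18HomotopyP08

/-! # `RootDecompQuadraticDescentPair18HomotopyP09` — part 9/31 of the mechanical ≤400-line split of `Pair18Homotopy_v14_noguard.lean` (sha256 72e9c8442b4af820…)
Source: decomp-kz lens-6 g9 `Pair18Homotopy.lean` v14 (HOME/decomp-kz-lens-6/g9/, sha256 3dda3232…; critic g4-48/g4-53/g4-56/g5 CLEARED; census pair #18 of crux stmt-KontsevichZagierPeriods-28994: homotopy cells, duplications, inversions, Euler–Landen, arc/angle regions; terminal `pair18_g8strips_of_grid : hEuler → hGrid → hAng4 → (g8 form of #18)`); `#guard_msgs … #print axioms` pins removed for landing.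
Split by census-1 g9 `gen/splitlean.py`: scopes re-opened with their `open`/`variable`/`set_option` context; mathematics and declaration order unchanged. -/

set_option linter.unusedSimpArgs false
noncomputable section
open _root_.Set MvPolynomial
namespace Summit.KontsevichZagierPeriods.RootDecompQuadraticDescent.Pair18Homotopy
open Literature.NumberTheory.Transcendental
open Literature.NumberTheory.Transcendental.KZ (RFun cube)
open Summit.KontsevichZagierPeriods.RootDecompQuadraticDescent.DarkPairs (rel_reflect_rep rel_double)
/-- Auxiliary step `vec2_1` (§2b): vec2 1. [bookkeeping] -/
private theorem vec2_1 (a b : ℝ) : (![a, b] : Fin 2 → ℝ) 1 = b := rfl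

/-- Auxiliary step `vec2_0` (§2b): vec2 0. [bookkeeping] -/
private theorem vec2_0 (a b : ℝ) : (![a, b] : Fin 2 → ℝ) 0 = a := rfl

section Inv0

open Literature.ModelTheory.ExponentialFields (IsSemialgebraic isSemialgebraic_setOf_eval_le)

/-- `Ω = {2w̃ ≤ 1 + t}`, i.e. `1 ≤ w ≤ 1 + m`. -/
def Ω : Set (Fin 2 → ℝ) := cube 2 ∩ {z | 2 * z 0 ≤ 1 + z 1}
/-- `ΩB = {t ≤ 2w̃ ≤ 1 + t}`, i.e. `m ≤ w ≤ 1 + m`. -/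
def ΩB : Set (Fin 2 → ℝ) := cube 2 ∩ {z | 2 * z 0 ≤ 1 + z 1} ∩ {z | z 1 ≤ 2 * z 0}
/-- the triangle `T = {2w̃ ≤ t}`, i.e. `1 ≤ w ≤ m`. -/
def Tri : Set (Fin 2 → ℝ) := cube 2 ∩ {z | 2 * z 0 ≤ z 1}
/-- the mirror triangle `T′ = {t ≤ 2w̃ ≤ 1}`, i.e. `m ≤ w ≤ 2`. -/
def Tri' : Set (Fin 2 → ℝ) := KZ.lowerHalfCube 0 ∩ {z | z 1 ≤ 2 * z 0}

/-- Auxiliary step `isSemialgebraic_le1`: is Semialgebraic le1. [bookkeeping] -/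
theorem isSemialgebraic_le1 : IsSemialgebraic ℚ {z : Fin 2 → ℝ | 2 * z 0 ≤ 1 + z 1} := by
  have h := isSemialgebraic_setOf_eval_le (R := ℝ) (C 2 * X 0 : MvPolynomial (Fin 2) ℚ) (C 1 + X 1 : MvPolynomial (Fin 2) ℚ)
  have e : {x : Fin 2 → ℝ | aeval x (C 2 * X 0 : MvPolynomial (Fin 2) ℚ) ≤ aeval x (C 1 + X 1 : MvPolynomial (Fin 2) ℚ)} =
      {z : Fin 2 → ℝ | 2 * z 0 ≤ 1 + z 1} := by
    ext z
    have e1 : aeval z (C 2 * X 0 : MvPolynomial (Fin 2) ℚ) = 2 * z 0 := by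
      simp only [map_add, map_mul, aeval_C, aeval_X, map_one, eq_ratCast, Rat.cast_ofNat, Rat.cast_one]
    have e2 : aeval z (C 1 + X 1 : MvPolynomial (Fin 2) ℚ) = 1 + z 1 := by
      simp only [map_add, map_mul, aeval_C, aeval_X, map_one, eq_ratCast, Rat.cast_ofNat, Rat.cast_one]
    simp only [mem_setOf_eq, e1, e2]
  rw [e] at h
  exact h
/-- Auxiliary step `isSemialgebraic_le2`: is Semialgebraic le2. [bookkeeping] -/
theorem isSemialgebraic_le2 : IsSemialgebraic ℚ {z : Fin 2 → ℝ | z 1 ≤ 2 * z 0} := by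
  have h := isSemialgebraic_setOf_eval_le (R := ℝ) (X 1 : MvPolynomial (Fin 2) ℚ) (C 2 * X 0 : MvPolynomial (Fin 2) ℚ)
  have e : {x : Fin 2 → ℝ | aeval x (X 1 : MvPolynomial (Fin 2) ℚ) ≤ aeval x (C 2 * X 0 : MvPolynomial (Fin 2) ℚ)} =
      {z : Fin 2 → ℝ | z 1 ≤ 2 * z 0} := by
    ext z
    have e1 : aeval z (X 1 : MvPolynomial (Fin 2) ℚ) = z 1 := by
      simp only [map_add, map_mul, aeval_C, aeval_X, map_one, eq_ratCast, Rat.cast_ofNat, Rat.cast_one]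
    have e2 : aeval z (C 2 * X 0 : MvPolynomial (Fin 2) ℚ) = 2 * z 0 := by
      simp only [map_add, map_mul, aeval_C, aeval_X, map_one, eq_ratCast, Rat.cast_ofNat, Rat.cast_one]
    simp only [mem_setOf_eq, e1, e2]
  rw [e] at h
  exact h
/-- Auxiliary step `isSemialgebraic_le3`: is Semialgebraic le3. [bookkeeping] -/
theorem isSemialgebraic_le3 : IsSemialgebraic ℚ {z : Fin 2 → ℝ | 2 * z 0 ≤ z 1} := by
  have h := isSemialgebraic_setOf_eval_le (R := ℝ) (C 2 * X 0 : MvPolynomial (Fin 2) ℚ) (X 1 : MvPolynomial (Fin 2) ℚ)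
  have e : {x : Fin 2 → ℝ | aeval x (C 2 * X 0 : MvPolynomial (Fin 2) ℚ) ≤ aeval x (X 1 : MvPolynomial (Fin 2) ℚ)} =
      {z : Fin 2 → ℝ | 2 * z 0 ≤ z 1} := by
    ext z
    have e1 : aeval z (C 2 * X 0 : MvPolynomial (Fin 2) ℚ) = 2 * z 0 := by
      simp only [map_add, map_mul, aeval_C, aeval_X, map_one, eq_ratCast, Rat.cast_ofNat, Rat.cast_one]
    have e2 : aeval z (X 1 : MvPolynomial (Fin 2) ℚ) = z 1 := by
      simp only [map_add, map_mul, aeval_C, aeval_X, map_one, eq_ratCast, Rat.cast_ofNat, Rat.cast_one]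
    simp only [mem_setOf_eq, e1, e2]
  rw [e] at h
  exact h
/-- Auxiliary step `isSemialgebraic_Ω`: is Semialgebraic Ω. [bookkeeping] -/
theorem isSemialgebraic_Ω : IsSemialgebraic ℚ Ω := KZ.isSemialgebraic_cube.inter isSemialgebraic_le1
/-- Auxiliary step `isSemialgebraic_ΩB`: is Semialgebraic ΩB. [bookkeeping] -/
theorem isSemialgebraic_ΩB : IsSemialgebraic ℚ ΩB :=
  (KZ.isSemialgebraic_cube.inter isSemialgebraic_le1).inter isSemialgebraic_le2
/-- Auxiliary step `isSemialgebraic_Tri`: is Semialgebraic Tri. [bookkeeping] -/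
theorem isSemialgebraic_Tri : IsSemialgebraic ℚ Tri := KZ.isSemialgebraic_cube.inter isSemialgebraic_le3
/-- Auxiliary step `isSemialgebraic_Tri'`: is Semialgebraic Tri'. [bookkeeping] -/
theorem isSemialgebraic_Tri' : IsSemialgebraic ℚ Tri' := (KZ.isSemialgebraic_lowerHalfCube 0).inter isSemialgebraic_le2

/-- Auxiliary step `Ω_sub`: Ω sub. [bookkeeping] -/
theorem Ω_sub : Ω ⊆ Mst.rep.domain := fun _ hz => hz.1
/-- Auxiliary step `ΩB_sub`: ΩB sub. [bookkeeping] -/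
theorem ΩB_sub : ΩB ⊆ Mst.rep.domain := fun _ hz => hz.1.1
/-- Auxiliary step `Tri_sub`: Tri sub. [bookkeeping] -/
theorem Tri_sub : Tri ⊆ Mst.rep.domain := fun _ hz => hz.1
/-- Auxiliary step `Tri'_sub`: Tri' sub. [bookkeeping] -/
theorem Tri'_sub : Tri' ⊆ Mst.rep.domain := fun _ hz => hz.1.1
/-- Auxiliary step `Half_sub`: Half sub. [bookkeeping] -/
theorem Half_sub : KZ.lowerHalfCube 0 ⊆ Mst.rep.domain := fun _ hz => hz.1

/-- the restricted master reps -/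
def MΩ : KZ.IntegralRep 2 := Mst.rep.restrict Ω isSemialgebraic_Ω Ω_sub
/-- Auxiliary definition `MΩB`: MΩB. [bookkeeping] -/
def MΩB : KZ.IntegralRep 2 := Mst.rep.restrict ΩB isSemialgebraic_ΩB ΩB_sub
/-- Auxiliary definition `MT`: MT. [bookkeeping] -/
def MT : KZ.IntegralRep 2 := Mst.rep.restrict Tri isSemialgebraic_Tri Tri_sub
/-- Auxiliary definition `MT'`: MT'. [bookkeeping] -/
def MT' : KZ.IntegralRep 2 := Mst.rep.restrict Tri' isSemialgebraic_Tri' Tri'_sub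
/-- Auxiliary definition `MQ`: MQ. [bookkeeping] -/
def MQ : KZ.IntegralRep 2 := Mst.rep.restrict (KZ.lowerHalfCube 0) (KZ.isSemialgebraic_lowerHalfCube 0) Half_sub

/-- the cutting line `2w̃ = t` (`w = m`) is Lebesgue-null. -/
theorem volume_cut : MeasureTheory.volume {z : Fin 2 → ℝ | 2 * z 0 = z 1} = 0 := by
  have h := volume_setOf_aeval_eq_zero (k := ℚ) (m := 2) (C 2 * X 0 - X 1) (by
    intro h0
    have := congr_arg (MvPolynomial.eval ![(1:ℝ), 0]) h0
    simp at this)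
  convert h using 2
  ext z
  simp [map_sub, map_mul, aeval_C, aeval_X, eq_ratCast, Rat.cast_ofNat, sub_eq_zero]

/-- **moving cut**: `[M|Ω] ≡ [M|T] + [M|ΩB]` (rule 1a along the line `w = m`). -/
theorem add_Ω : KZ.of MΩ - KZ.of MT - KZ.of MΩB ∈ KZ.relations := by
  refine KZ.domainAddRel_subset_relations ⟨2, MΩ, MT, MΩB, ?_, ?_, fun _ _ => rfl, fun _ _ => rfl, rfl⟩
  · simp only [MΩ, MT, MΩB, KZ.IntegralRep.domain_restrict]
    ext z
    simp only [Ω, Tri, ΩB, mem_inter_iff, mem_union, mem_setOf_eq]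
    constructor
    · rintro ⟨hc, h⟩
      rcases le_total (2 * z 0) (z 1) with h' | h'
      · exact Or.inl ⟨hc, h'⟩
      · exact Or.inr ⟨⟨hc, h⟩, h'⟩
    · rintro (⟨hc, h⟩ | ⟨⟨hc, h⟩, h'⟩)
      · exact ⟨hc, by linarith [(hc 1).1]⟩
      · exact ⟨hc, h⟩
  · simp only [MT, MΩB, KZ.IntegralRep.domain_restrict]
    refine MeasureTheory.measure_mono_null (fun z hz => ?_) volume_cut
    simp only [Tri, ΩB, mem_inter_iff, mem_setOf_eq] at hz ⊢
    linarith [hz.1.2, hz.2.2]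

/-- `[M|lower half] ≡ [M|T] + [M|T′]` (rule 1a along the same line). -/
theorem add_Q : KZ.of MQ - KZ.of MT - KZ.of MT' ∈ KZ.relations := by
  refine KZ.domainAddRel_subset_relations ⟨2, MQ, MT, MT', ?_, ?_, fun _ _ => rfl, fun _ _ => rfl, rfl⟩
  · simp only [MQ, MT, MT', KZ.IntegralRep.domain_restrict]
    ext z
    simp only [Tri, Tri', KZ.mem_lowerHalfCube, mem_inter_iff, mem_union, mem_setOf_eq]
    constructor
    · rintro ⟨hc, h⟩
      rcases le_total (2 * z 0) (z 1) with h' | h'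
      · exact Or.inl ⟨hc, h'⟩
      · exact Or.inr ⟨⟨hc, h⟩, h'⟩
    · rintro (⟨hc, h⟩ | ⟨⟨hc, h⟩, h'⟩)
      · exact ⟨hc, by linarith [(hc 1).2]⟩
      · exact ⟨hc, h⟩
  · simp only [MT, MT', KZ.IntegralRep.domain_restrict]
    refine MeasureTheory.measure_mono_null (fun z hz => ?_) volume_cut
    simp only [Tri, Tri', KZ.mem_lowerHalfCube, mem_inter_iff, mem_setOf_eq] at hz ⊢
    linarith [hz.1.2, hz.2.2]

/-! ### the three changes of variables into the master square, and the lower half -/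

/-- `[Av] ≡ [M|Ω]` via `(v,t) ↦ (w̃,t) = ((1+t)v/2, t)` (`w = 1 + m v`). -/
theorem Av_cov : KZ.of Av.rep - KZ.of MΩ ∈ KZ.relations := by
  let Φ : (Fin 2 → ℝ) → (Fin 2 → ℝ) := fun z => ![2⁻¹ * ((1 + z 1) * z 0), z 1]
  let Mz : (Fin 2 → ℝ) → Matrix (Fin 2) (Fin 2) ℝ := fun z => !![(1 + z 1) / 2, z 0 / 2; 0, 1]
  let Φ' : (Fin 2 → ℝ) → (Fin 2 → ℝ) →L[ℝ] (Fin 2 → ℝ) := fun z =>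
    LinearMap.toContinuousLinearMap (Matrix.toLin' (Mz z))
  have hΦ'ap : ∀ z w, Φ' z w = ![(1 + z 1) / 2 * w 0 + z 0 / 2 * w 1, w 1] := by
    intro z w; funext i
    fin_cases i <;> simp [Φ', Mz, Matrix.toLin'_apply, Matrix.mulVec, dotProduct, Fin.sum_univ_two]
  have hdet : ∀ z, (Φ' z).det = (1 + z 1) / 2 := by
    intro z
    unfold ContinuousLinearMap.det
    simp [Φ', LinearMap.det_toLin', Mz, Matrix.det_fin_two]
  have hdom : MΩ.domain = Φ '' Av.rep.domain := by
    rw [RFun.rep_domain]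
    simp only [MΩ, KZ.IntegralRep.domain_restrict]
    ext w
    constructor
    · rintro ⟨hw, hle⟩
      have hw0 := (hw 0).1
      have hw1 := (hw 1).1
      have hw1' := (hw 1).2
      have h2 : (0 : ℝ) < 1 + w 1 := by linarith
      refine ⟨![2 * w 0 / (1 + w 1), w 1], ?_, ?_⟩
      · intro i
        fin_cases i
        · refine ⟨by simpa using div_nonneg (by linarith) h2.le, ?_⟩
          simpa using (div_le_one h2).mpr (by simpa [mem_setOf_eq] using hle)
        · exact hw 1
      · funext i
        fin_cases i
        · have key : 2⁻¹ * ((1 + w 1) * (2 * w 0 / (1 + w 1))) = w 0 := by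
            field_simp
          simpa [Φ] using key
        · simp [Φ]
    · rintro ⟨z, hz, rfl⟩
      have hz0 := (hz 0).1
      have hz0' := (hz 0).2
      have hz1 := (hz 1).1
      have hz1' := (hz 1).2
      refine ⟨fun i => ?_, ?_⟩
      · fin_cases i
        · refine ⟨by simp [Φ]; positivity, ?_⟩
          simp [Φ]
          nlinarith [mul_nonneg hz1 hz0]
        · simpa [Φ] using hz 1
      · simp only [mem_setOf_eq, Φ, vec2_0, vec2_1, Matrix.cons_val_zero, Matrix.cons_val_one, Matrix.head_cons]
        nlinarith [mul_nonneg hz1 hz0]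
  refine KZ.changeOfVariablesRel_subset_relations ⟨2, Av.rep, MΩ, Φ, Φ', ?_, ?_, ?_, hdom, ?_, rfl⟩
  · refine (isSemialgebraicMapOn_iff_forall_holds Av.rep.isSemialgebraic_domain).mpr fun i => ?_
    fin_cases i
    · exact (isSemialgebraicFunOn_aeval Av.rep.isSemialgebraic_domain (C (1 / 2) * ((C 1 + X 1) * X 0))).congr
        fun z _ => by simp [Φ, map_add, map_sub, map_mul, map_pow, map_neg, aeval_C, aeval_X, map_one, map_ofNat, eq_ratCast, Rat.cast_one, Rat.cast_ofNat, Rat.cast_div, Rat.cast_neg, vec2_0, vec2_1, Matrix.cons_val_zero, Matrix.cons_val_one, Matrix.head_cons]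
    · exact (isSemialgebraicFunOn_aeval Av.rep.isSemialgebraic_domain (X 1)).congr fun z _ => by simp [Φ]
  · intro z hz
    have h0 : HasFDerivAt (fun w : Fin 2 → ℝ => 2⁻¹ * ((1 + w 1) * w 0))
        ((2⁻¹ : ℝ) • ((1 + z 1) • ContinuousLinearMap.proj (R := ℝ) (φ := fun _ : Fin 2 => ℝ) 0 +
          z 0 • ContinuousLinearMap.proj (R := ℝ) (φ := fun _ : Fin 2 => ℝ) 1)) z :=
      (((hasFDerivAt_apply (𝕜 := ℝ) 1 z).const_add 1).mul (hasFDerivAt_apply (𝕜 := ℝ) 0 z)).const_mul 2⁻¹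
    have h1 : HasFDerivAt (fun w : Fin 2 → ℝ => w 1)
        (ContinuousLinearMap.proj (R := ℝ) (φ := fun _ : Fin 2 => ℝ) 1) z := hasFDerivAt_apply 1 z
    have hpi : HasFDerivAt Φ (Φ' z) z := by
      rw [hasFDerivAt_pi']
      intro i
      fin_cases i
      · have e : (ContinuousLinearMap.proj (R := ℝ) (φ := fun _ : Fin 2 => ℝ) 0).comp (Φ' z) =
            (2⁻¹ : ℝ) • ((1 + z 1) • ContinuousLinearMap.proj (R := ℝ) (φ := fun _ : Fin 2 => ℝ) 0 +
              z 0 • ContinuousLinearMap.proj (R := ℝ) (φ := fun _ : Fin 2 => ℝ) 1) := by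
          ext w; simp [hΦ'ap]; try ring
        simpa [e, Φ, Function.comp_def] using h0
      · have e : (ContinuousLinearMap.proj (R := ℝ) (φ := fun _ : Fin 2 => ℝ) 1).comp (Φ' z) =
            ContinuousLinearMap.proj (R := ℝ) (φ := fun _ : Fin 2 => ℝ) 1 := by
          ext w; simp [hΦ'ap]
        simpa [e, Φ] using h1
    exact hpi.hasFDerivWithinAt
  · intro z₁ hz₁ z₂ hz₂ heq
    have ha := (hz₁ 1).1
    have e1 : z₁ 1 = z₂ 1 := by simpa [Φ] using congrFun heq 1
    have e0 : 2⁻¹ * ((1 + z₁ 1) * z₁ 0) = 2⁻¹ * ((1 + z₂ 1) * z₂ 0) := by simpa [Φ] using congrFun heq 0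
    rw [e1] at e0
    have hpos : (0 : ℝ) < 1 + z₂ 1 := by linarith [(hz₂ 1).1]
    have e0' : z₁ 0 = z₂ 0 := by nlinarith
    funext i
    fin_cases i
    · exact e0'
    · exact e1
  · intro z hz
    have hz0 : (0 : ℝ) ≤ z 0 := (hz 0).1
    have hz1 : (0 : ℝ) ≤ z 1 := (hz 1).1
    have hp : (0 : ℝ) < 1 + z 1 := by linarith
    have hq : (0 : ℝ) < 1 + (1 + z 1) * z 0 := by nlinarith [mul_nonneg hz1 hz0]
    rw [hdet, RFun.rep_integrand, abs_of_pos (by positivity)]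
    simp only [MΩ, KZ.IntegralRep.integrand_restrict, RFun.rep_integrand]
    simp only [Av, Mst, AvDen, MstDen, RFun.fn, Φ, map_add, map_sub, map_mul, map_pow, map_neg, aeval_C, aeval_X, map_one, map_ofNat, eq_ratCast, Rat.cast_one, Rat.cast_ofNat, Rat.cast_div, Rat.cast_neg, vec2_0, vec2_1, Matrix.cons_val_zero, Matrix.cons_val_one, Matrix.head_cons]
    field_simp
    try ring

end Inv0
end Summit.KontsevichZagierPeriods.RootDecompQuadraticDescent.Pair18Homotopy
end
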